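import Literature.Geometry.Lorentzian.HarmonicallyFlatConformal
import Literature.Geometry.Lorentzian.MassCapacityPotential
import Literature.Geometry.Lorentzian.MassCapacityHarmonic
import Mathlib.Geometry.Manifold.BumpFunction
import HarnessLib

/-!
# Conformal covariance of the Laplace–Beltrami operator in dimension three:
# `Δ_h(χ u) = χ⁵ Δ_{χ⁴h} u + u Δ_h χ`

For a Riemannian `3`-manifold `(X, h)` and a smooth positive function `χ`, the Laplace–Beltrami
operators of `h` and of the conformal metric `χ⁴ h` are related by
`Δ_h(χ u) = χ⁵ Δ_{χ⁴ h} u + u Δ_h χ` — the conformal covariance of the conformal Laplacian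
`L = −8Δ + R` (`L_{χ⁴h} u = χ⁻⁵ L_h(χ u)`) combined with the transformation of the scalar
curvature `R(χ⁴ h) = χ⁻⁵ (R(h) χ − 8 Δ_h χ)`. Bray, J. Differential Geom. 59 (2001), App. A
("`R(u⁴ g) = u⁻⁵(−8Δ_g + R(g)) u`") and §6, proof of Thm. 9 (before (102): *"the operator
`−8Δ + R` is conformally invariant"* is how the harmonic function of the smoothed metric is
produced); Lee–Parker, *The Yamabe problem*, Bull. AMS 17 (1987), (2.7). It is the device by
which `h`-harmonic functions on `X` correspond to solutions of `(Δ_{χ⁴h} − V) u = 0`,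
`V = −χ⁻⁵ Δ_h χ`, on a conformal compactification.

* `InitialDataSet.dalembertian_conformal_mul_of_pos` — the identity for positive smooth `u`,
  read off from the scalar-curvature law (`scalarCurvature_conformal_fourth_power`,
  `ConformalChange.lean`) applied to the one metric `(χ u)⁴ h = u⁴ (χ⁴ h)` in two ways;
* `InitialDataSet.dalembertian_conformal_mul` — the identity for every smooth `u` (locality of
  `Δ`, a bump function and a large additive constant reduce to the positive case).

Everything is proved; nothing is defined and no named fact is introduced.

## References

* H. L. Bray, *Proof of the Riemannian Penrose inequality using the positive mass theorem*,
  J. Differential Geom. 59 (2001) 177–267, App. A and §6 (before (102)). [BrayRPI2001]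
* R. Schoen, S.-T. Yau, *On the proof of the positive mass conjecture in general relativity*,
  Comm. Math. Phys. 65 (1979), (3.8) (`R(φ⁴ ds²) = φ⁻⁵(Rφ − 8Δφ)`). [SchoenYauPMT1979]
-/

noncomputable section

open Set Function Filter Topology Manifold
open scoped Manifold ContDiff Topology

namespace Literature.Geometry.Lorentzian

open PseudoRiemannianMetric

namespace InitialDataSet

variable {X : Type} [TopologicalSpace X] [ChartedSpace E3 X] [IsManifold (𝓡 3) ∞ X]

/-- **`Δ_h(χ u) = χ⁵ Δ_{χ⁴h} u + u Δ_h χ` for positive smooth `u`.** Both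
`u⁴ (χ⁴ h)` and `(χ u)⁴ h` are the same metric, so the scalar-curvature law gives
`u⁻⁵ (R(χ⁴h) u − 8 Δ_{χ⁴h} u) = (χu)⁻⁵ (R(h) χ u − 8 Δ_h(χ u))`, and with
`R(χ⁴ h) = χ⁻⁵ (R(h) χ − 8 Δ_h χ)` the scalar curvatures cancel. Bray 2001, App. A.
[cite: BrayRPI2001, App. A] [cite: SchoenYauPMT1979, (3.8)] -/
theorem dalembertian_conformal_mul_of_pos (D : InitialDataSet (𝓡 3) X) [D.metric.HasLeviCivita]
    {χ : X → ℝ} (hχ : ContMDiff (𝓡 3) 𝓘(ℝ) ∞ χ) (hχpos : ∀ x, 0 < χ x)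
    {u : X → ℝ} (hu : ContMDiff (𝓡 3) 𝓘(ℝ) ∞ u) (hupos : ∀ x, 0 < u x) (x : X) :
    haveI := (D.conformal χ hχ hχpos).metric.hasLeviCivita
    D.metric.dalembertian (fun y ↦ χ y * u y) x =
      χ x ^ 5 * (D.conformal χ hχ hχpos).metric.dalembertian u x +
        u x * D.metric.dalembertian χ x := by
  haveI := (D.conformal χ hχ hχpos).metric.hasLeviCivita
  have hχu : ContMDiff (𝓡 3) 𝓘(ℝ) ∞ (fun y ↦ χ y * u y) := hχ.mul hu
  have hχupos : ∀ y, 0 < χ y * u y := fun y ↦ mul_pos (hχpos y) (hupos y)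
  haveI := (D.conformal _ hχu hχupos).metric.hasLeviCivita
  -- the three instances of the scalar-curvature law
  have L0 := scalarCurvature_conformal_fourth_power D.metric (D.conformal χ hχ hχpos).metric
    D.isRiemannian_metric hχ hχpos (fun y v w ↦ D.metric_conformal_val χ hχ hχpos y v w) x
  have L1 := scalarCurvature_conformal_fourth_power (D.conformal χ hχ hχpos).metric
    (D.conformal _ hχu hχupos).metric (D.conformal χ hχ hχpos).isRiemannian_metric hu hupos
    (fun y v w ↦ by
      rw [D.metric_conformal_val _ hχu hχupos y v w, D.metric_conformal_val χ hχ hχpos y v w]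
      ring) x
  have L2 := scalarCurvature_conformal_fourth_power D.metric (D.conformal _ hχu hχupos).metric
    D.isRiemannian_metric hχu hχupos (fun y v w ↦ D.metric_conformal_val _ hχu hχupos y v w) x
  -- algebra
  set R := D.metric.scalarCurvature x
  set R' := (D.conformal χ hχ hχpos).metric.scalarCurvature x
  set R'' := (D.conformal _ hχu hχupos).metric.scalarCurvature x
  set a := D.metric.dalembertian (fun y ↦ χ y * u y) x
  set b := (D.conformal χ hχ hχpos).metric.dalembertian u x
  set c := D.metric.dalembertian χ x
  have hχ0 : χ x ≠ 0 := (hχpos x).ne'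
  have hu0 : u x ≠ 0 := (hupos x).ne'
  have e0 : R' * χ x ^ 5 = R * χ x - 8 * c := by
    rw [L0]; field_simp
  have e1 : R'' * u x ^ 5 = R' * u x - 8 * b := by
    rw [L1]; field_simp
  have e2 : R'' * (χ x * u x) ^ 5 = R * (χ x * u x) - 8 * a := by
    rw [L2]; field_simp
  have e2' : R'' * u x ^ 5 * χ x ^ 5 = R * (χ x * u x) - 8 * a := by
    rw [← e2]; ring
  rw [e1] at e2'
  -- `(R' u − 8 b) χ⁵ = R χ u − 8 a` and `R' χ⁵ = R χ − 8 c`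
  have e3 : R' * χ x ^ 5 * u x - 8 * b * χ x ^ 5 = R * (χ x * u x) - 8 * a := by
    rw [← e2']; ring
  rw [e0] at e3
  linarith

/-- **Conformal covariance of the Laplace–Beltrami operator: `Δ_h(χ u) = χ⁵ Δ_{χ⁴h} u + u Δ_h χ`**
for every smooth `u` on a Hausdorff Riemannian `3`-manifold (`χ > 0` smooth). Reduction to the
positive case: `Δ` is local (`dalembertian_congr_of_eventuallyEq`), and near a given point `u`
agrees with `θ u + K`, `θ` a smooth bump function and `K` a constant exceeding `sup |θ u|`,
which is positive and smooth; constants and the term `K χ` are removed by linearity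
(`dalembertian_affine_apply`, `dalembertian_sub`). Bray 2001, App. A, and §6 before (102) ("the
operator `−8Δ + R` is conformally invariant"). [cite: BrayRPI2001, App. A and §6 (102)] -/
theorem dalembertian_conformal_mul [T2Space X] (D : InitialDataSet (𝓡 3) X)
    [D.metric.HasLeviCivita] {χ : X → ℝ} (hχ : ContMDiff (𝓡 3) 𝓘(ℝ) ∞ χ)
    (hχpos : ∀ x, 0 < χ x) {u : X → ℝ} (hu : ContMDiff (𝓡 3) 𝓘(ℝ) ∞ u) (x : X) :
    haveI := (D.conformal χ hχ hχpos).metric.hasLeviCivita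
    D.metric.dalembertian (fun y ↦ χ y * u y) x =
      χ x ^ 5 * (D.conformal χ hχ hχpos).metric.dalembertian u x +
        u x * D.metric.dalembertian χ x := by
  haveI := (D.conformal χ hχ hχpos).metric.hasLeviCivita
  haveI : (ofRiemannian D.h).HasLeviCivita := ‹D.metric.HasLeviCivita›
  haveI : (ofRiemannian (D.conformal χ hχ hχpos).h).HasLeviCivita :=
    ‹(D.conformal χ hχ hχpos).metric.HasLeviCivita›
  -- a bump function at `x` and a bound for `θ u`
  obtain ⟨θ⟩ : Nonempty (SmoothBumpFunction (𝓡 3) x) := inferInstance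
  have hθu : ContMDiff (𝓡 3) 𝓘(ℝ) ∞ (fun y ↦ θ y * u y) := θ.contMDiff.mul hu
  have hcs : HasCompactSupport (fun y ↦ θ y * u y) := θ.hasCompactSupport.mul_right
  obtain ⟨K₀, hK₀⟩ := hθu.continuous.bounded_above_of_compact_support hcs
  set K : ℝ := |K₀| + 1 with hK_def
  set v : X → ℝ := fun y ↦ θ y * u y + K with hv_def
  have hvpos : ∀ y, 0 < v y := fun y ↦ by
    have h1 : ‖θ y * u y‖ ≤ K₀ := hK₀ y
    rw [Real.norm_eq_abs] at h1
    have h2 : -(θ y * u y) ≤ |K₀| := (neg_le_abs _).trans (h1.trans (le_abs_self _))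
    show 0 < θ y * u y + K
    rw [hK_def]; linarith
  have hv : ContMDiff (𝓡 3) 𝓘(ℝ) ∞ v := hθu.add contMDiff_const
  have key := D.dalembertian_conformal_mul_of_pos hχ hχpos hv hvpos x
  -- near `x`: `θ = 1`, so `v = 1·u + K` and `χ u = χ v − (K χ + 0)`
  have hθ1 : (θ : X → ℝ) =ᶠ[𝓝 x] 1 := θ.eventuallyEq_one
  have hv_loc : v =ᶠ[𝓝 x] fun y ↦ 1 * u y + K := hθ1.mono fun y hy ↦ by
    show θ y * u y + K = 1 * u y + K
    rw [hy, Pi.one_apply]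
  have hχu_loc : (fun y ↦ χ y * u y) =ᶠ[𝓝 x] ((fun y ↦ χ y * v y) - fun y ↦ K * χ y + 0) :=
    hθ1.mono fun y hy ↦ by
      show χ y * u y = χ y * (θ y * u y + K) - (K * χ y + 0)
      rw [hy, Pi.one_apply]; ring
  have h2le : ((2 : ℕ) : ℕ∞ω) ≤ ∞ := WithTop.coe_le_coe.mpr le_top
  have hu2 : ContMDiffAt (𝓡 3) 𝓘(ℝ, ℝ) 2 u x := (hu x).of_le h2le
  have hχ2 : ContMDiffAt (𝓡 3) 𝓘(ℝ, ℝ) 2 χ x := (hχ x).of_le h2le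
  have hχv2 : ContMDiffAt (𝓡 3) 𝓘(ℝ, ℝ) 2 (fun y ↦ χ y * v y) x := ((hχ.mul hv) x).of_le h2le
  have hτ2 : ContMDiffAt (𝓡 3) 𝓘(ℝ, ℝ) 2 (fun y ↦ K * χ y + 0) x :=
    (contMDiffAt_const.mul hχ2).add contMDiffAt_const
  -- `Δ' v = Δ' u`
  have hb : (D.conformal χ hχ hχpos).metric.dalembertian v x =
      (D.conformal χ hχ hχpos).metric.dalembertian u x := by
    rw [dalembertian_congr_of_eventuallyEq _ hv_loc]
    have h := dalembertian_affine_apply (D.conformal χ hχ hχpos).h 1 K hu2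
    rw [one_mul] at h
    exact h
  -- `Δ(χ u) = Δ(χ v) − K Δ χ`
  have ha : D.metric.dalembertian (fun y ↦ χ y * u y) x =
      D.metric.dalembertian (fun y ↦ χ y * v y) x - K * D.metric.dalembertian χ x := by
    rw [dalembertian_congr_of_eventuallyEq _ hχu_loc, dalembertian_sub _ hχv2 hτ2]
    have h : D.metric.dalembertian (fun y ↦ K * χ y + 0) x = K * D.metric.dalembertian χ x :=
      dalembertian_affine_apply D.h K 0 hχ2
    rw [h]
  have hvx : v x = u x + K := by
    show θ x * u x + K = u x + K
    rw [θ.eq_one, one_mul]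
  rw [ha, key, hb, hvx]
  ring

end InitialDataSet

end Literature.Geometry.Lorentzian

end
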